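import Literature.NumberTheory.EllipticCurves.KramerDescentLocalGeneratorsProofs
import HarnessLib

/-!
# Kramer's `2`-descent: the intermediate fact `Kramer1983_shaG_span` of `KramerDescent.lean` — PROVED

K. Kramer, *A family of semistable elliptic curves with large Tate–Shafarevitch groups*,
Proc. Amer. Math. Soc. **89** (1983), 379–386 [Kramer1983], §5: the exact sequence
(9) `0 → A(ℚ)/gB(ℚ) → S(A/gB) → Ш(B, ℚ)_g → 0` and the inclusion (10) `Ш(B, ℚ)₂ ⊇ Ш(B, ℚ)_g`,
applied (proof of the Theorem, p. 383) to the subgroup of `ℚ*/ℚ*² = H¹(ℚ, B_g)` "generated by the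
cosets of `−1` and the primes in `𝔏 ∪ 𝔐`" (`= S(A/gB)`).

`KramerDescent.lean` states this as the named fact `Kramer1983_shaG_span` — for Kramer's parameters
`P` there is a homomorphism `Φ : 𝔽₂ × 𝔽₂^{𝔏∪𝔐} → Ш(B/ℚ) ⊓ H¹(ℚ, B)[2]`, `e ↦` the class of the span
element `a(e)`, with `Φ e = 0` only if `[a(e)] ∈ γ(A(ℚ))` — and PROVES it there from the two leaves
`Kramer1983_selmerG_generators_local` (Lemma 2 + Remark of §4: the generators lie in every local
image `γ_v(A(ℚ_v))`) and `Kramer1983_shaG_of_selmerG` (§3 (4), §5 (9)–(10): the map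
`H¹(ℚ, B_g) → H¹(ℚ, B)`, its kernel and its compatibility with localisation), in
`Kramer1983_shaG_span_of_local_global`. Both leaves are now theorems of the tree:
`Kramer1983_selmerG_generators_local_holds` (`KramerDescentLocalGeneratorsProofs`) and
`Kramer1983_shaG_of_selmerG_holds` (`KramerDescentShaGProofs`). This file records the resulting
unconditional discharge `Kramer1983_shaG_span_holds`.

## References

* K. Kramer, Proc. Amer. Math. Soc. 89 (1983) 379–386, doi:10.1090/s0002-9939-1983-0715850-1:
  §5 (9)–(10) (p. 382) and the proof of the Theorem (p. 383). [Kramer1983] (held, read in full).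
-/

noncomputable section

namespace Literature.NumberTheory.EllipticCurves

/-- **Kramer 1983, §5 (9)–(10) with p. 383 — the fact `Kramer1983_shaG_span` PROVED.** For
Kramer's parameters (`m = m₁⋯mₙ s`, `ℓ = 16m + 1 = ℓ₁⋯ℓₙ r`, conditions (i)–(iv) of the Theorem of
§5) there is a homomorphism `Φ : 𝔽₂ × 𝔽₂^{𝔏∪𝔐} → Ш(B/ℚ)[2]` sending the exponent vector `e` to the
image under (9) `S(A/gB) → Ш(B, ℚ)_g ⊆ Ш(B, ℚ)₂` (10) of the span element
`a(e) = (−1)^{e(∞)} ∏ p^{e(p)}`, whose kernel consists of `e` with `[a(e)] ∈ γ(A(ℚ))` (exactness of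
(9) at `S(A/gB)`). Obtained from `Kramer1983_shaG_span_of_local_global` (`KramerDescent`) fed with
the two proved leaves `Kramer1983_selmerG_generators_local_holds` (Lemma 2 and the Remark of §4
over the completions) and `Kramer1983_shaG_of_selmerG_holds` (the map `H¹(ℚ, B_g) → H¹(ℚ, B)` of
diagram (4)). [cite: Kramer1983, §5 (9)–(10) and proof of the Theorem, p. 383] -/
theorem Kramer1983_shaG_span_holds : Kramer1983_shaG_span :=
  Kramer1983_shaG_span_of_local_global Kramer1983_selmerG_generators_local_holds
    Kramer1983_shaG_of_selmerG_holds

end Literature.NumberTheory.EllipticCurves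

end
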